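import Mathlib.Analysis.Convex.SimplicialComplex.Basic
import Mathlib.Analysis.Normed.Module.FiniteDimension
import Mathlib.Topology.MetricSpace.Bounded
import Literature.Analysis.Convexity.SignArrangementChains
import HarnessLib

/-!
# Sign arrangements: the exit point of a ray and the chain triangulation

Conclusion of `Literature.Analysis.Convexity.SignArrangement` /
`Literature.Analysis.Convexity.SignArrangementChains`, now on a finite-dimensional real normed
space (so that the functionals are continuous and closed faces are closed, `isClosed_cl`).

* `exists_exit` — **the exit point**: if `p ∈ face L ε`, `x ≠ p` lies in `cl L ε` and the closed
  face is bounded, the ray from `p` through `x` leaves `cl L ε` at a point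
  `y = p + T • (x - p)`, `T ≥ 1`, of `cl L ε \ face L ε` (a supremum argument; the face is open
  along the line because finitely many strict inequalities stay strict nearby);
* `exists_chain_mem_convexHull` — **covering**: every point of a face `ε ∈ Φ` lies in the chain
  simplex of a chain with greatest element `ε` (induction on the number of nonzero entries of
  `ε`, using the exit point);
* `exists_simplicialComplex` — **the chain triangulation**: for a finite family `Φ` of sign
  vectors with nonempty faces, closed under passing to smaller sign vectors with nonempty faces
  and with bounded closed faces, and chosen points `b ε ∈ face L ε`, the chain simplices form a
  finite geometric simplicial complex (Mathlib's `Geometry.SimplicialComplex`) whose underlying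
  space contains every face in `Φ`, each simplex lying in the closed face of the greatest element
  of its chain.

Used in `Literature.Topology.FourManifolds.PLManifoldComp` (composition of PL maps,
Rourke–Sanderson (1972), 2.14).  All statements are standard and tagged `[folklore]`.
-/

open Set Function

noncomputable section

namespace Literature.Analysis.Convexity

namespace SignArrangement

/-! ### Topology: closed faces are closed; the exit point of a ray -/

section Topology

variable {E : Type*} [NormedAddCommGroup E] [NormedSpace ℝ E] [FiniteDimensional ℝ E]
  {ι : Type*} {L : ι → E →ᵃ[ℝ] ℝ} {ε : ι → SignType} {x p : E}

/-- Closed faces are closed (finite-dimensional `E`, so the functionals are continuous).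
[folklore] -/
theorem isClosed_cl (L : ι → E →ᵃ[ℝ] ℝ) (ε : ι → SignType) : IsClosed (cl L ε) := by
  have hcl : cl L ε = ⋂ i, ({x | ε i = 1 → 0 ≤ L i x} ∩ {x | ε i = -1 → L i x ≤ 0} ∩
      {x | ε i = 0 → L i x = 0}) := by
    ext x
    simp only [mem_cl_iff, Set.mem_iInter, Set.mem_inter_iff, Set.mem_setOf_eq, and_assoc]
  rw [hcl]
  refine isClosed_iInter fun i => ?_
  have hc : Continuous (L i) := (L i).continuous_of_finiteDimensional
  refine (IsClosed.inter ?_ ?_).inter ?_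
  · by_cases h : ε i = 1
    · simpa [h] using isClosed_le continuous_const hc
    · simp [h]
  · by_cases h : ε i = -1
    · simpa [h] using isClosed_le hc continuous_const
    · simp [h]
  · by_cases h : ε i = 0
    · simpa [h] using isClosed_eq hc continuous_const
    · simp [h]

/-- **Exit point.** Let `p` lie in the face `ε`, let `x ≠ p` lie in the closed face `ε`, and let
the closed face be bounded. Then the ray from `p` through `x` leaves the closed face at a point
`y = p + T • (x - p)`, `T ≥ 1`, which lies in the closed face but not in the face (so its sign
vector is strictly below `ε`). [folklore] -/
theorem exists_exit [Finite ι] (hp : p ∈ face L ε) (hx : x ∈ cl L ε) (hxp : x ≠ p)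
    (hbdd : Bornology.IsBounded (cl L ε)) :
    ∃ T : ℝ, 1 ≤ T ∧ p + T • (x - p) ∈ cl L ε ∧ p + T • (x - p) ∉ face L ε := by
  set d : E := x - p with hd
  have hd0 : d ≠ 0 := sub_ne_zero.2 hxp
  set φ : ℝ → E := fun t => p + t • d with hφ
  have hφc : Continuous φ := continuous_const.add (continuous_id.smul continuous_const)
  set S : Set ℝ := {t | 0 ≤ t ∧ φ t ∈ cl L ε} with hS
  have h1 : (1 : ℝ) ∈ S := by
    refine ⟨zero_le_one, ?_⟩
    show p + (1 : ℝ) • (x - p) ∈ cl L ε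
    rwa [one_smul, add_sub_cancel]
  have hSc : IsClosed S := isClosed_Ici.inter ((isClosed_cl L ε).preimage hφc)
  have hSb : BddAbove S := by
    obtain ⟨R, hR⟩ := hbdd.subset_closedBall p
    refine ⟨R / ‖d‖, fun t ht => ?_⟩
    have h := hR ht.2
    rw [Metric.mem_closedBall, dist_eq_norm] at h
    have hφt : φ t - p = t • d := by simp [hφ]
    rw [hφt, norm_smul, Real.norm_of_nonneg ht.1] at h
    rwa [le_div_iff₀ (norm_pos_iff.2 hd0)]
  set T : ℝ := sSup S with hT
  have hTS : T ∈ S := hSc.csSup_mem ⟨1, h1⟩ hSb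
  have h1T : 1 ≤ T := le_csSup hSb h1
  refine ⟨T, h1T, hTS.2, fun hy => ?_⟩
  -- the face is open along the line, contradicting maximality of `T`
  have hev : ∀ᶠ t in nhds T, φ t ∈ face L ε := by
    have key : ∀ i, ∀ᶠ t in nhds T, SignType.sign (L i (φ t)) = ε i := by
      intro i
      have hci : Continuous fun t => L i (φ t) := (L i).continuous_of_finiteDimensional.comp hφc
      have hpi : SignType.sign (L i p) = ε i := congr_fun hp i
      have hyi : SignType.sign (L i (φ T)) = ε i := congr_fun hy i
      rcases hε : ε i with _ | _ | _
      · rw [hε] at hpi hyi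
        have h0p : L i p = 0 := sign_eq_zero_iff.1 hpi
        have h0T : L i (φ T) = 0 := sign_eq_zero_iff.1 hyi
        have hlin : (L i).linear d = 0 := by
          have h := h0T
          simp only [hφ] at h
          rw [apply_add_smul, h0p, zero_add] at h
          exact (mul_eq_zero.1 h).resolve_left (by linarith)
        refine Filter.Eventually.of_forall fun t => ?_
        simp only [hφ]
        rw [apply_add_smul, h0p, hlin, mul_zero, add_zero, sign_zero]
        rfl
      · rw [hε] at hyi
        have hneg : L i (φ T) < 0 := sign_eq_neg_one_iff.1 hyi
        filter_upwards [hci.continuousAt.eventually (gt_mem_nhds hneg)] with t ht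
        exact sign_neg ht
      · rw [hε] at hyi
        have hpos : 0 < L i (φ T) := sign_eq_one_iff.1 hyi
        filter_upwards [hci.continuousAt.eventually (lt_mem_nhds hpos)] with t ht
        exact sign_pos ht
    filter_upwards [Filter.eventually_all.2 key] with t ht
    exact funext ht
  obtain ⟨δ, hδ, hballδ⟩ := Metric.eventually_nhds_iff.1 hev
  have ht₀ : T + δ / 2 ∈ S := by
    refine ⟨by linarith, face_subset_cl (hballδ ?_)⟩
    rw [Real.dist_eq, add_sub_cancel_left, abs_of_pos (by linarith)]
    linarith
  have := le_csSup hSb ht₀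
  linarith

/-! ### The chain triangulation -/

variable {Φ : Finset (ι → SignType)} {b : (ι → SignType) → E}

/-- Passing to a strictly smaller sign vector strictly decreases the number of nonzero entries.
[folklore] -/
theorem card_filter_ne_zero_lt [Fintype ι] {ε' : ι → SignType} (h : SLE ε' ε) (hne : ε' ≠ ε) :
    (Finset.univ.filter fun i => ε' i ≠ 0).card < (Finset.univ.filter fun i => ε i ≠ 0).card := by
  classical
  refine Finset.card_lt_card ((Finset.ssubset_iff_of_subset fun i hi => ?_).2 ?_)
  · rw [Finset.mem_filter] at hi ⊢
    refine ⟨hi.1, fun h0 => hi.2 (h.apply_eq_zero h0)⟩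
  · obtain ⟨i, hi0, hi⟩ := h.exists_eq_zero_ne_zero hne
    exact ⟨i, Finset.mem_filter.2 ⟨Finset.mem_univ i, hi⟩, fun h' => (Finset.mem_filter.1 h').2 hi0⟩

/-- **Covering by chain simplices.** Let `Φ` be a finite family of sign vectors with nonempty
faces, closed under passing to smaller sign vectors with nonempty faces, with bounded closed
faces, and let `b ε ∈ face L ε` be chosen points. Then every point of a face `ε ∈ Φ` lies in the
simplex spanned by the chosen points of a chain in `Φ` with greatest element `ε` (induction on
the number of nonzero entries of `ε`, using the exit point `exists_exit`). [folklore] -/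
theorem exists_chain_mem_convexHull [Finite ι] [DecidableEq E]
    (hb : ∀ ε ∈ Φ, b ε ∈ face L ε)
    (hdown : ∀ ε ∈ Φ, ∀ ε', SLE ε' ε → (face L ε').Nonempty → ε' ∈ Φ)
    (hbdd : ∀ ε ∈ Φ, Bornology.IsBounded (cl L ε)) :
    ∀ ε ∈ Φ, ∀ x ∈ face L ε, ∃ C : Finset (ι → SignType), C ⊆ Φ ∧ ε ∈ C ∧
      IsChain SLE (C : Set (ι → SignType)) ∧ (∀ G ∈ C, SLE G ε) ∧
      x ∈ convexHull ℝ ((C.image b : Finset E) : Set E) := by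
  classical
  cases nonempty_fintype ι
  suffices h : ∀ n, ∀ ε ∈ Φ, (Finset.univ.filter fun i => ε i ≠ 0).card = n → ∀ x ∈ face L ε,
      ∃ C : Finset (ι → SignType), C ⊆ Φ ∧ ε ∈ C ∧ IsChain SLE (C : Set (ι → SignType)) ∧
        (∀ G ∈ C, SLE G ε) ∧ x ∈ convexHull ℝ ((C.image b : Finset E) : Set E) from
    fun ε hε x hx => h _ ε hε rfl x hx
  intro n
  induction n using Nat.strong_induction_on with
  | _ n ih =>
  intro ε hε hn x hx
  by_cases hxb : x = b ε
  · refine ⟨{ε}, by simpa using hε, Finset.mem_singleton_self ε, ?_, fun G hG => ?_, ?_⟩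
    · rw [Finset.coe_singleton]
      exact Set.pairwise_singleton ε _
    · rw [Finset.mem_singleton] at hG
      subst hG
      exact SLE.rfl
    · rw [hxb, Finset.image_singleton, Finset.coe_singleton]
      exact subset_convexHull ℝ _ (Set.mem_singleton _)
  obtain ⟨T, h1T, hycl, hyface⟩ := exists_exit (hb ε hε) (face_subset_cl hx) hxb (hbdd ε hε)
  have hT0 : 0 < T := by linarith
  set y : E := b ε + T • (x - b ε) with hy
  set ε' : ι → SignType := svec L y with hε'
  have hyε' : y ∈ face L ε' := rfl
  have hsle : SLE ε' ε := hycl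
  have hne : ε' ≠ ε := fun h => hyface (h ▸ hyε')
  have hε'Φ : ε' ∈ Φ := hdown ε hε ε' hsle ⟨y, hyε'⟩
  have hlt : (Finset.univ.filter fun i => ε' i ≠ 0).card < n :=
    hn ▸ card_filter_ne_zero_lt hsle hne
  obtain ⟨C', hC'Φ, -, hchain', hle', hyconv⟩ := ih _ hlt ε' hε'Φ rfl y hyε'
  refine ⟨insert ε C', Finset.insert_subset hε hC'Φ, Finset.mem_insert_self ε C', ?_, ?_, ?_⟩
  · rw [Finset.coe_insert]
    exact hchain'.insert fun G hG _ => Or.inr ((hle' G hG).trans hsle)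
  · intro G hG
    rcases Finset.mem_insert.1 hG with rfl | hG
    · exact SLE.rfl
    · exact (hle' G hG).trans hsle
  · have hxy : x = (1 - 1 / T) • b ε + (1 / T) • y := by
      rw [hy, smul_add, smul_smul, one_div, inv_mul_cancel₀ hT0.ne', one_smul, sub_smul, one_smul]
      abel
    rw [hxy]
    refine convex_convexHull ℝ _ ?_ (convexHull_mono ?_ hyconv) ?_ ?_ ?_
    · exact subset_convexHull ℝ _
        (Finset.mem_coe.2 (Finset.mem_image_of_mem b (Finset.mem_insert_self ε C')))
    · exact Finset.coe_subset.2 (Finset.image_subset_image (Finset.subset_insert ε C'))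
    · rw [sub_nonneg, div_le_one hT0]
      exact h1T
    · positivity
    · ring

/-- **The chain triangulation of a sign arrangement.** Let `L` be finitely many affine
functionals on a finite-dimensional real normed space, `Φ` a finite set of sign vectors with
nonempty faces which is closed under passing to smaller sign vectors with nonempty faces and
whose closed faces are bounded, and `b ε ∈ face L ε` chosen points. Then the simplices spanned by
the chosen points of the chains in `Φ` form a finite geometric simplicial complex whose
underlying space contains every face `ε ∈ Φ`, each simplex lying in the closed face of the
greatest element of its chain. (The barycentric-subdivision argument for the cell complex of an
arrangement, with arbitrary interior points in place of barycentres.) [folklore] -/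
theorem exists_simplicialComplex [Finite ι] [DecidableEq E] (L : ι → E →ᵃ[ℝ] ℝ)
    (Φ : Finset (ι → SignType)) (b : (ι → SignType) → E) (hb : ∀ ε ∈ Φ, b ε ∈ face L ε)
    (hdown : ∀ ε ∈ Φ, ∀ ε', SLE ε' ε → (face L ε').Nonempty → ε' ∈ Φ)
    (hbdd : ∀ ε ∈ Φ, Bornology.IsBounded (cl L ε)) :
    ∃ P : Geometry.SimplicialComplex ℝ E, P.faces.Finite ∧ (∀ ε ∈ Φ, face L ε ⊆ P.space) ∧
      ∀ t ∈ P.faces, ∃ ε ∈ Φ, convexHull ℝ (t : Set E) ⊆ cl L ε := by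
  classical
  let faces : Set (Finset E) := {t | ∃ C : Finset (ι → SignType), C ⊆ Φ ∧ C.Nonempty ∧
    IsChain SLE (C : Set (ι → SignType)) ∧ C.image b = t}
  refine ⟨{ faces := faces
            isRelLowerSet_faces := ?_
            indep := ?_
            inter_subset_convexHull := ?_ }, ?_, ?_, ?_⟩
  · rintro _ ⟨C, hCΦ, hCne, hC, rfl⟩
    refine ⟨hCne.image b, fun t ht htne => ?_⟩
    refine ⟨C.filter fun G => b G ∈ t, (Finset.filter_subset _ _).trans hCΦ, ?_,
      hC.mono (Finset.coe_subset.2 (Finset.filter_subset _ _)), ?_⟩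
    · obtain ⟨y, hy⟩ := htne
      obtain ⟨G, hG, rfl⟩ := Finset.mem_image.1 (ht hy)
      exact ⟨G, Finset.mem_filter.2 ⟨hG, hy⟩⟩
    · ext y
      simp only [Finset.mem_image, Finset.mem_filter]
      constructor
      · rintro ⟨G, ⟨-, hGt⟩, rfl⟩
        exact hGt
      · intro hy
        obtain ⟨G, hG, rfl⟩ := Finset.mem_image.1 (ht hy)
        exact ⟨G, ⟨hG, hy⟩, rfl⟩
  · rintro _ ⟨C, hCΦ, -, hC, rfl⟩
    exact affineIndependent_of_isChain hb C hCΦ hC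
  · rintro _ _ ⟨C₁, h₁, -, hC₁, rfl⟩ ⟨C₂, h₂, -, hC₂, rfl⟩
    exact convexHull_image_inter_subset hb h₁ h₂ hC₁ hC₂
  · refine ((Φ.powerset.image fun C => C.image b).finite_toSet).subset ?_
    rintro _ ⟨C, hCΦ, -, -, rfl⟩
    exact Finset.mem_coe.2 (Finset.mem_image.2 ⟨C, Finset.mem_powerset.2 hCΦ, rfl⟩)
  · intro ε hε x hx
    obtain ⟨C, hCΦ, hεC, hC, -, hxC⟩ := exists_chain_mem_convexHull hb hdown hbdd ε hε x hx
    exact Geometry.SimplicialComplex.convexHull_subset_space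
      (K := { faces := faces, isRelLowerSet_faces := _, indep := _, inter_subset_convexHull := _ })
      ⟨C, hCΦ, ⟨ε, hεC⟩, hC, rfl⟩ hxC
  · rintro _ ⟨C, hCΦ, hCne, hC, rfl⟩
    obtain ⟨F, hF, hmax⟩ := exists_max_of_isChain hC hCne
    exact ⟨F, hCΦ hF, convexHull_image_subset_cl hb hCΦ hmax⟩

end Topology

end SignArrangement

end Literature.Analysis.Convexity
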